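import Summits.ValiantsHypothesis.ValiantsHypothesis.Theorems.SymPencilAdjugateExpansion

/-!
# Route `SymPencil` — the origin moments of a symmetric determinantal representation of a quartic
# (tool file for the rung `sdc(per_4) ≥ 18`, `--supports` stmt-ValiantsHypothesis-5674)

Pure matrix algebra.  Let `D` be invertible, `C₀` any square matrix, `a₀, κ, φ` scalars and `b₀` a
vector, and suppose that for every scalar `s`

  `det [[s a₀, s b₀ᵀ], [s b₀, D + s C₀]] = κ · s⁴ · φ`.                                  (E)

(This is the shape of `det (A₀ + s M(z)) = det P² · s⁴ · f(z)` for a SYMMETRIC affine determinantal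
representation `A₀ + M(z)` of a QUARTIC form `f`, in a basis through the kernel vector of `A₀`:
`SymPencilOriginNormalForm`.)  Then (`moments_four`):

* `a₀ = 0`;
* `b₀ᵀ D⁻¹ b₀ = 0` (isotropy of the kernel rows);
* `b₀ᵀ D⁻¹ C₀ D⁻¹ b₀ = 0` (the first moment);
* `det D · b₀ᵀ D⁻¹ C₀ D⁻¹ C₀ D⁻¹ b₀ = -κ φ` (the quartic is the second moment).

Proof: off the finitely many `s` with `det (D + s C₀) = 0` the bordered determinant is
`det (D + s C₀) (s a₀ - s² b₀ᵀ (D + s C₀)⁻¹ b₀) = s a₀ det (D + s C₀) - s² b₀ᵀ adj (D + s C₀) b₀`,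
so the polynomial `a₀ X det (D + X C₀) - X² b₀ᵀ adj (D + X C₀) b₀ - κ φ X⁴` has infinitely many
roots, hence vanishes; its coefficients of `X, X², X³, X⁴` are read off with
`SymPencilAdjugateExpansion.coeff_bilin_adjugate_line`. [folklore]
-/

noncomputable section

-- single-conjunct layout: Sub = Summit, duplicated namespace component intended
set_option linter.dupNamespace false

namespace Summit.ValiantsHypothesis.ValiantsHypothesis.Theorems.SymPencilOriginMoments

open Matrix Polynomial
open Summit.ValiantsHypothesis.ValiantsHypothesis.Theorems.SymPencilHomogeneousDropTools
open Summit.ValiantsHypothesis.ValiantsHypothesis.Theorems.SymPencilAdjugateExpansion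

universe u

variable {k : Type u} [Field k] {ι' : Type*} [Fintype ι'] [DecidableEq ι']

/-- **Bordered determinant with invertible lower-right block**:
`det [[c, qᵀ], [q, S]] = det S · (c - qᵀ S⁻¹ q)`. [folklore] -/
theorem det_fromBlocks_border {S : Matrix ι' ι' k} (hS : IsUnit S.det) (c : k) (q : ι' → k) :
    (Matrix.fromBlocks (c • (1 : Matrix Unit Unit k)) (Matrix.replicateRow Unit q)
        (Matrix.replicateCol Unit q) S).det = S.det * (c - q ⬝ᵥ S⁻¹ *ᵥ q) := by
  letI : Invertible S := Matrix.invertibleOfIsUnitDet S hS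
  rw [Matrix.det_fromBlocks₂₂,
    Matrix.det_unique (c • (1 : Matrix Unit Unit k) -
      Matrix.replicateRow Unit q * ⅟S * Matrix.replicateCol Unit q),
    Matrix.invOf_eq_nonsing_inv]
  congr 1
  rw [Matrix.sub_apply, Matrix.smul_apply, Matrix.one_apply_eq, smul_eq_mul, mul_one]
  congr 1
  simp only [Matrix.mul_apply, Matrix.replicateRow_apply, Matrix.replicateCol_apply, dotProduct,
    Matrix.mulVec, Finset.sum_mul]
  rw [Finset.sum_comm]
  exact Finset.sum_congr rfl fun i _ => by
    rw [Finset.mul_sum]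
    exact Finset.sum_congr rfl fun j _ => by ring

/-- Evaluating the polynomial `(C b) ⬝ adj (D + X N) (C b')` at `s` gives `b ⬝ adj (D + s N) b'`.
[folklore] -/
theorem eval_bilin_adjugate_line (D N : Matrix ι' ι' k) (b b' : ι' → k) (s : k) :
    ((fun i => Polynomial.C (b i)) ⬝ᵥ
        adjugate (D.map Polynomial.C + (Polynomial.X : k[X]) • N.map Polynomial.C) *ᵥ
        (fun i => Polynomial.C (b' i))).eval s = b ⬝ᵥ adjugate (D + s • N) *ᵥ b' := by
  have hmat : (D.map Polynomial.C + (Polynomial.X : k[X]) • N.map Polynomial.C).map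
      (Polynomial.evalRingHom s) = D + s • N := by
    ext i j
    simp [Matrix.map_apply]
    ring
  have hadj : (adjugate (D.map Polynomial.C + (Polynomial.X : k[X]) • N.map Polynomial.C)).map
      (Polynomial.evalRingHom s) = adjugate (D + s • N) := by
    rw [← RingHom.mapMatrix_apply, RingHom.map_adjugate, RingHom.mapMatrix_apply, hmat]
  rw [← Polynomial.coe_evalRingHom]
  simp only [dotProduct, Matrix.mulVec, map_sum, map_mul, Polynomial.coe_evalRingHom,
    Polynomial.eval_C]
  refine Finset.sum_congr rfl fun i _ => ?_
  congr 1
  refine Finset.sum_congr rfl fun j _ => ?_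
  congr 1
  have h := congr_fun (congr_fun hadj i) j
  rw [Matrix.map_apply] at h
  exact h

variable [CharZero k]

/-- **The origin moments of a symmetric determinantal representation of a quartic.**  If
`det [[s a₀, s b₀ᵀ], [s b₀, D + s C₀]] = κ s⁴ φ` for all `s`, with `D` invertible, then `a₀ = 0`,
`b₀ᵀ D⁻¹ b₀ = 0`, `b₀ᵀ D⁻¹ C₀ D⁻¹ b₀ = 0` and `det D · b₀ᵀ D⁻¹ C₀ D⁻¹ C₀ D⁻¹ b₀ = -κ φ`.
[folklore] -/
theorem moments_four {D C₀ : Matrix ι' ι' k} (hD : IsUnit D.det) (a₀ κ φ : k) (b₀ : ι' → k)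
    (hE : ∀ s : k, (Matrix.fromBlocks ((s * a₀) • (1 : Matrix Unit Unit k))
        (Matrix.replicateRow Unit (s • b₀)) (Matrix.replicateCol Unit (s • b₀)) (D + s • C₀)).det =
        κ * s ^ 4 * φ) :
    a₀ = 0 ∧ b₀ ⬝ᵥ D⁻¹ *ᵥ b₀ = 0 ∧ b₀ ⬝ᵥ (D⁻¹ * C₀ * D⁻¹) *ᵥ b₀ = 0 ∧
      D.det * (b₀ ⬝ᵥ (D⁻¹ * C₀ * D⁻¹ * C₀ * D⁻¹) *ᵥ b₀) = -(κ * φ) := by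
  classical
  have hD0 : D.det ≠ 0 := hD.ne_zero
  -- the two polynomials in play
  set δ : k[X] := (D.map Polynomial.C + (Polynomial.X : k[X]) • C₀.map Polynomial.C).det with hδ
  set g : k[X] := (fun i => Polynomial.C (b₀ i)) ⬝ᵥ
      adjugate (D.map Polynomial.C + (Polynomial.X : k[X]) • C₀.map Polynomial.C) *ᵥ
      (fun i => Polynomial.C (b₀ i)) with hg
  set Q : k[X] := Polynomial.C a₀ * (Polynomial.X ^ 1 * δ) - Polynomial.X ^ 2 * g -
      Polynomial.C (κ * φ) * Polynomial.X ^ 4 with hQ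
  -- `Q` vanishes wherever `det (D + s C₀) ≠ 0`
  have hroot : ∀ s : k, (D + s • C₀).det ≠ 0 → Q.IsRoot s := by
    intro s hs
    have hSu : IsUnit (D + s • C₀).det := isUnit_iff_ne_zero.2 hs
    have h1 := hE s
    rw [det_fromBlocks_border hSu, Matrix.mulVec_smul, dotProduct_smul, smul_dotProduct,
      smul_eq_mul, smul_eq_mul] at h1
    have hadj : b₀ ⬝ᵥ adjugate (D + s • C₀) *ᵥ b₀ =
        (D + s • C₀).det * (b₀ ⬝ᵥ (D + s • C₀)⁻¹ *ᵥ b₀) := by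
      have : adjugate (D + s • C₀) = (D + s • C₀).det • (D + s • C₀)⁻¹ := by
        rw [Matrix.nonsing_inv_apply _ hSu, smul_smul, IsUnit.mul_val_inv, one_smul]
      rw [this, Matrix.smul_mulVec, dotProduct_smul, smul_eq_mul]
    rw [Polynomial.IsRoot.def, hQ]
    simp only [Polynomial.eval_sub, Polynomial.eval_mul, Polynomial.eval_C, Polynomial.eval_X,
      Polynomial.eval_pow]
    rw [hδ, eval_detLine, hg, eval_bilin_adjugate_line, hadj]
    linear_combination h1
  -- hence `Q = 0`
  have hQ0 : Q = 0 := by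
    apply Polynomial.eq_zero_of_infinite_isRoot
    have hδ0 : δ ≠ 0 := by
      intro h
      have h0 := coeff_detLine_zero D C₀
      rw [← hδ, h, Polynomial.coeff_zero] at h0
      exact hD0 h0.symm
    have hfin : Set.Finite {s : k | δ.IsRoot s} := (δ.roots.toFinset.finite_toSet).subset
      fun s hs => by
        simp only [Set.mem_setOf_eq] at hs
        simp only [Finset.mem_coe, Multiset.mem_toFinset, Polynomial.mem_roots hδ0]
        exact hs
    refine (hfin.infinite_compl).mono fun s hs => ?_
    simp only [Set.mem_compl_iff, Set.mem_setOf_eq, Polynomial.IsRoot.def, hδ, eval_detLine] at hs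
    exact hroot s hs
  -- the coefficients of `g`
  obtain ⟨d₁, d₂, hg0, hg1, hg2⟩ := coeff_bilin_adjugate_line hD C₀ b₀ b₀
  rw [← hg] at hg0 hg1 hg2
  have hδc0 : δ.coeff 0 = D.det := by rw [hδ, coeff_detLine_zero]
  -- read off the coefficients of `Q`
  have hc : ∀ n, Q.coeff n = 0 := fun n => by rw [hQ0, Polynomial.coeff_zero]
  have hQn : ∀ n, Q.coeff n = a₀ * (if 1 ≤ n then δ.coeff (n - 1) else 0) -
      (if 2 ≤ n then g.coeff (n - 2) else 0) - (if n = 4 then κ * φ else 0) := by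
    intro n
    rw [hQ, Polynomial.coeff_sub, Polynomial.coeff_sub, Polynomial.coeff_C_mul,
      Polynomial.coeff_X_pow_mul', Polynomial.coeff_X_pow_mul', Polynomial.coeff_C_mul_X_pow]
  have e1 := hQn 1
  have e2 := hQn 2
  have e3 := hQn 3
  have e4 := hQn 4
  norm_num at e1 e2 e3 e4
  rw [hc] at e1 e2 e3 e4
  rw [hδc0] at e1
  have h1 : a₀ = 0 := by
    rcases mul_eq_zero.1 e1.symm with h | h
    · exact h
    · exact absurd h hD0
  rw [h1, zero_mul, zero_sub] at e2 e3 e4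
  rw [hg0] at e2
  have h2 : b₀ ⬝ᵥ D⁻¹ *ᵥ b₀ = 0 := by
    rcases mul_eq_zero.1 (neg_eq_zero.1 e2.symm) with h | h
    · exact absurd h hD0
    · exact h
  rw [hg1, h2, mul_zero, zero_sub] at e3
  have h3 : b₀ ⬝ᵥ (D⁻¹ * C₀ * D⁻¹) *ᵥ b₀ = 0 := by
    have h := neg_eq_zero.1 e3.symm
    rw [mul_neg, neg_eq_zero] at h
    rcases mul_eq_zero.1 h with h | h
    · exact absurd h hD0
    · exact h
  rw [hg2, h2, h3, mul_zero, mul_zero, zero_sub, neg_zero, zero_add] at e4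
  have h4 : D.det * (b₀ ⬝ᵥ (D⁻¹ * C₀ * D⁻¹ * C₀ * D⁻¹) *ᵥ b₀) = -(κ * φ) := by
    linear_combination e4
  exact ⟨h1, h2, h3, h4⟩

end Summit.ValiantsHypothesis.ValiantsHypothesis.Theorems.SymPencilOriginMoments

end
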